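import Summits.HodgeConjecture.HodgeConjecture.Cruxes.BlochSeedDiscOne.DepthBoundA4

/-!
# The 2-adic μ-law (strengthen g8, S⁺ ledger row #87): `4 ∣ T(hhhh)` and `4 ∣ μ` for INTEGER (A1)-clean designs
# on the (even) height-14 alphabet

An INTEGRALITY law of PHASE-TORUS type — a finite letter calculus that the rational relaxation does not see.
On the height-14 alphabet `a + |x| + |y| = 14`, so `β̄ = x − iy ≡ a (mod 1+i)` for every letter.  Writing
`β̄_f − a_f = (1+i)·γ_f` on each factor and expanding `∏_f (β̄_f − a_f)` over the sixteen `{e,h}`-words, the (A1)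
condition (every mixed `{e,h}`-word vanishes) leaves `T(hhhh) + μ = (1+i)⁴ · (…)`, and the same expansion on three
factors leaves `−T(hhhh) = (1+i)³ · (…)`; since `T(hhhh)` is a rational integer this gives `4 ∣ T(hhhh)`, hence
`(1+i)⁴ = −4 ∣ μ`, i.e. `4 ∣ Re μ` and `4 ∣ Im μ`.

STATUS WORD: a kernel theorem about the LETTER model of `DepthBoundA4.lean` (v1.8); evidence-grade bookkeeping, letters ≠
sheaves ≠ SEED; nothing here is a step toward HC ∕ HC_CM ∕ HC_AV ∕ 18881.  As a ROUTE it is STRUCK (memo-12 v1.1.2): the data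
cap every universal 2-adic strengthening at `v_{1+i}(μ) ≤ 20` (H077-single's primitive integer multiple), which excludes nothing
at `copies ≤ 199`.  It is filed because it is the first statement in this crux directory that USES integrality of the
multiplicities — the ingredient Leg A (`DepthBound 14 199 8 5 ⟺ Nonex 14 199 8`) now provably needs.
-/

namespace Summit.HodgeConjecture.HodgeConjecture.Cruxes.BlochSeedDiscOne.TwoAdicMuLaw

open Summit.HodgeConjecture.HodgeConjecture.Cruxes.BlochSeedDiscOne.DepthBoundA4

/-! ## §1 Arithmetic in ℤ[i]: π = 1 + i -/

/-- `π = 1 + i`. -/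
def piG : GaussianInt := ⟨1, 1⟩

theorem piG_pow_four : piG ^ 4 = -4 := by decide

theorem piG_pow_three : piG ^ 3 = ⟨-2, 2⟩ := by decide

/-- `π³ ∣ n` for a rational integer `n` (as an element of ℤ[i] with `im = 0`) forces `4 ∣ n`. -/
theorem four_dvd_of_pi_cube_dvd (z : GaussianInt) (hz : z.im = 0) (h : piG ^ 3 ∣ z) :
    (4 : ℤ) ∣ z.re ∧ (4 : ℤ) ∣ z.im := by
  rw [piG_pow_three] at h
  obtain ⟨q, hq⟩ := h
  have hre : z.re = -2 * q.re - 2 * q.im := by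
    have := congrArg Zsqrtd.re hq; simp [Zsqrtd.re_mul] at this; linarith
  have him : z.im = 2 * q.re - 2 * q.im := by
    have := congrArg Zsqrtd.im hq; simp [Zsqrtd.im_mul] at this; linarith
  refine ⟨⟨-q.re, ?_⟩, ⟨0, by simp [hz]⟩⟩
  have : q.re = q.im := by linarith [hz.symm.trans him]
  rw [hre, ← this]; ring

/-- The parity fact: on the height-14 alphabet `β̄ − a` is divisible by `π = 1 + i`. -/
theorem pi_dvd_letter (ℓ : Letter) (h : ℓ.OnAlphabet 14) :
    piG ∣ star ℓ.beta - (ℓ.a : GaussianInt) := by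
  obtain ⟨hh, _⟩ := h
  unfold Letter.height at hh
  have hpar : ∃ u : ℤ, ℓ.x - ℓ.a - ℓ.y = 2 * u := by
    rcases abs_choice ℓ.x with hx | hx <;> rcases abs_choice ℓ.y with hy | hy <;> rw [hx, hy] at hh
    · exact ⟨(ℓ.x - ℓ.a - ℓ.y) / 2, by omega⟩
    · exact ⟨(ℓ.x - ℓ.a - ℓ.y) / 2, by omega⟩
    · exact ⟨(ℓ.x - ℓ.a - ℓ.y) / 2, by omega⟩
    · exact ⟨(ℓ.x - ℓ.a - ℓ.y) / 2, by omega⟩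
  obtain ⟨u, hu⟩ := hpar
  refine ⟨⟨u, u - ℓ.x + ℓ.a⟩, ?_⟩
  rw [Zsqrtd.ext_iff]
  simp [Letter.beta, piG, Zsqrtd.re_mul, Zsqrtd.im_mul]
  constructor <;> linarith

/-! ## §2 The sixteen `{e,h}`-words -/

/-- `hhhh`. -/
def wH : Word := ![Sym.h, Sym.h, Sym.h, Sym.h]
def m1000 : Word := ![Sym.e, Sym.h, Sym.h, Sym.h]
def m0100 : Word := ![Sym.h, Sym.e, Sym.h, Sym.h]
def m0010 : Word := ![Sym.h, Sym.h, Sym.e, Sym.h]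
def m0001 : Word := ![Sym.h, Sym.h, Sym.h, Sym.e]
def m1100 : Word := ![Sym.e, Sym.e, Sym.h, Sym.h]
def m1010 : Word := ![Sym.e, Sym.h, Sym.e, Sym.h]
def m1001 : Word := ![Sym.e, Sym.h, Sym.h, Sym.e]
def m0110 : Word := ![Sym.h, Sym.e, Sym.e, Sym.h]
def m0101 : Word := ![Sym.h, Sym.e, Sym.h, Sym.e]
def m0011 : Word := ![Sym.h, Sym.h, Sym.e, Sym.e]
def m1110 : Word := ![Sym.e, Sym.e, Sym.e, Sym.h]
def m1101 : Word := ![Sym.e, Sym.e, Sym.h, Sym.e]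
def m1011 : Word := ![Sym.e, Sym.h, Sym.e, Sym.e]
def m0111 : Word := ![Sym.h, Sym.e, Sym.e, Sym.e]

/-- The four-factor product `∏_f (β̄_f − a_f)` of a cell. -/
def G4 (c : Cell) : GaussianInt :=
  (star (c 0).beta - ((c 0).a : GaussianInt)) * (star (c 1).beta - ((c 1).a : GaussianInt)) *
    (star (c 2).beta - ((c 2).a : GaussianInt)) * (star (c 3).beta - ((c 3).a : GaussianInt))

/-- The three-factor product `(β̄₀ − a₀)(β̄₁ − a₁)(β̄₂ − a₂)·a₃` of a cell. -/
def G3 (c : Cell) : GaussianInt :=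
  (star (c 0).beta - ((c 0).a : GaussianInt)) * (star (c 1).beta - ((c 1).a : GaussianInt)) *
    (star (c 2).beta - ((c 2).a : GaussianInt)) * ((c 3).a : GaussianInt)

theorem G4_expand (c : Cell) : G4 c =
    cellCoef c wH - (cellCoef c m1000 + cellCoef c m0100 + cellCoef c m0010 + cellCoef c m0001)
      + (cellCoef c m1100 + cellCoef c m1010 + cellCoef c m1001 + cellCoef c m0110 + cellCoef c m0101 + cellCoef c m0011)
      - (cellCoef c m1110 + cellCoef c m1101 + cellCoef c m1011 + cellCoef c m0111) + cellCoef c Word.eeee := by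
  unfold G4 cellCoef wH m1000 m0100 m0010 m0001 m1100 m1010 m1001 m0110 m0101 m0011 m1110 m1101 m1011 m0111 Word.eeee
  simp [Fin.prod_univ_four, Sym.coef]
  ring

theorem G3_expand (c : Cell) : G3 c =
    - cellCoef c wH + (cellCoef c m1000 + cellCoef c m0100 + cellCoef c m0010)
      - (cellCoef c m1100 + cellCoef c m1010 + cellCoef c m0110) + cellCoef c m1110 := by
  unfold G3 cellCoef wH m1000 m0100 m0010 m1100 m1010 m0110 m1110
  simp [Fin.prod_univ_four, Sym.coef]
  ring

/-- `hhhh` has a rational-integer cell coefficient. -/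
theorem cellCoef_wH_im (c : Cell) : (cellCoef c wH).im = 0 := by
  unfold cellCoef wH
  simp [Fin.prod_univ_four, Sym.coef, Zsqrtd.im_mul, Zsqrtd.re_mul]

/-! ## §3 Weighted sums: linearity, divisibility, realness -/

/-- `Σ m·u(c)` over a list of (cell, multiplicity) entries. -/
def wsum (L : List (Cell × ℕ)) (u : Cell → GaussianInt) : GaussianInt :=
  (L.map fun cm => (cm.2 : GaussianInt) * u cm.1).sum

theorem wsum_add (L : List (Cell × ℕ)) (u v : Cell → GaussianInt) :
    wsum L (fun c => u c + v c) = wsum L u + wsum L v := by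
  induction L with
  | nil => simp [wsum]
  | cons a t ih =>
    simp only [wsum, List.map_cons, List.sum_cons] at ih ⊢
    rw [ih]; ring

theorem wsum_sub' (L : List (Cell × ℕ)) (u v : Cell → GaussianInt) :
    wsum L (fun c => u c - v c) = wsum L u - wsum L v := by
  induction L with
  | nil => simp [wsum]
  | cons a t ih =>
    simp only [wsum, List.map_cons, List.sum_cons] at ih ⊢
    rw [ih]; ring

theorem wsum_neg (L : List (Cell × ℕ)) (u : Cell → GaussianInt) :
    wsum L (fun c => - u c) = - wsum L u := by
  induction L with
  | nil => simp [wsum]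
  | cons a t ih =>
    simp only [wsum, List.map_cons, List.sum_cons] at ih ⊢
    rw [ih]; ring

theorem dvd_wsum (L : List (Cell × ℕ)) (u : Cell → GaussianInt) (d : GaussianInt)
    (h : ∀ cm ∈ L, 0 < cm.2 → d ∣ u cm.1) : d ∣ wsum L u := by
  induction L with
  | nil => simp [wsum]
  | cons a t ih =>
    have ht : d ∣ wsum t u := ih fun cm hcm => h cm (List.mem_cons_of_mem _ hcm)
    simp only [wsum, List.map_cons, List.sum_cons] at ht ⊢
    refine dvd_add ?_ ht
    rcases Nat.eq_zero_or_pos a.2 with h0 | hpos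
    · simp [h0]
    · exact dvd_mul_of_dvd_right (h a List.mem_cons_self hpos) _

theorem wsum_im_zero (L : List (Cell × ℕ)) (u : Cell → GaussianInt) (h : ∀ c, (u c).im = 0) :
    (wsum L u).im = 0 := by
  induction L with
  | nil => simp [wsum]
  | cons a t ih =>
    simp only [wsum, List.map_cons, List.sum_cons] at ih ⊢
    simp [Zsqrtd.im_mul, h, ih]

/-- `T` as a linear functional of the cell-coefficient function. -/
def Tf (D : Design) (u : Cell → GaussianInt) : GaussianInt := wsum D.N u - wsum D.P u

theorem T_eq_Tf (D : Design) (w : Word) : D.T w = Tf D (fun c => cellCoef c w) := rfl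

theorem Tf_add (D : Design) (u v : Cell → GaussianInt) : Tf D (fun c => u c + v c) = Tf D u + Tf D v := by
  unfold Tf; rw [wsum_add, wsum_add]; ring

theorem Tf_sub (D : Design) (u v : Cell → GaussianInt) : Tf D (fun c => u c - v c) = Tf D u - Tf D v := by
  unfold Tf; rw [wsum_sub', wsum_sub']; ring

theorem Tf_neg (D : Design) (u : Cell → GaussianInt) : Tf D (fun c => - u c) = - Tf D u := by
  unfold Tf; rw [wsum_neg, wsum_neg]; ring

/-- Support cells of an `OnAlphabet 14` design have all four letters on the alphabet (N side). -/
theorem onAlpha_N (D : Design) (hA : D.OnAlphabet 14) :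
    ∀ cm ∈ D.N, 0 < cm.2 → ∀ f : Fin 4, (cm.1 f).OnAlphabet 14 := by
  intro cm hcm hpos f
  have hc : cm.1 ∈ D.suppN := (mem_suppN_iff D cm.1).mpr ⟨cm.2, hcm, hpos⟩
  exact hA cm.1 (List.mem_append.mpr (Or.inl hc)) f

/-- … and on the P side. -/
theorem onAlpha_P (D : Design) (hA : D.OnAlphabet 14) :
    ∀ cm ∈ D.P, 0 < cm.2 → ∀ f : Fin 4, (cm.1 f).OnAlphabet 14 := by
  intro cm hcm hpos f
  have hc : cm.1 ∈ D.suppP := (mem_suppP_iff D cm.1).mpr ⟨cm.2, hcm, hpos⟩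
  exact hA cm.1 (List.mem_append.mpr (Or.inr hc)) f

theorem pi4_dvd_G4 (c : Cell) (h : ∀ f : Fin 4, (c f).OnAlphabet 14) : piG ^ 4 ∣ G4 c := by
  have e : piG ^ 4 = piG * piG * piG * piG := by ring
  rw [e]; unfold G4
  exact mul_dvd_mul (mul_dvd_mul (mul_dvd_mul (pi_dvd_letter _ (h 0)) (pi_dvd_letter _ (h 1)))
    (pi_dvd_letter _ (h 2))) (pi_dvd_letter _ (h 3))

theorem pi3_dvd_G3 (c : Cell) (h : ∀ f : Fin 4, (c f).OnAlphabet 14) : piG ^ 3 ∣ G3 c := by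
  have e : piG ^ 3 = piG * piG * piG := by ring
  rw [e]; unfold G3
  exact dvd_mul_of_dvd_left (mul_dvd_mul (mul_dvd_mul (pi_dvd_letter _ (h 0)) (pi_dvd_letter _ (h 1)))
    (pi_dvd_letter _ (h 2))) _

theorem pi4_dvd_Tf_G4 (D : Design) (hA : D.OnAlphabet 14) : piG ^ 4 ∣ Tf D G4 := by
  unfold Tf
  exact dvd_sub (dvd_wsum _ _ _ fun cm hcm hpos => pi4_dvd_G4 _ (onAlpha_N D hA cm hcm hpos))
    (dvd_wsum _ _ _ fun cm hcm hpos => pi4_dvd_G4 _ (onAlpha_P D hA cm hcm hpos))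

theorem pi3_dvd_Tf_G3 (D : Design) (hA : D.OnAlphabet 14) : piG ^ 3 ∣ Tf D G3 := by
  unfold Tf
  exact dvd_sub (dvd_wsum _ _ _ fun cm hcm hpos => pi3_dvd_G3 _ (onAlpha_N D hA cm hcm hpos))
    (dvd_wsum _ _ _ fun cm hcm hpos => pi3_dvd_G3 _ (onAlpha_P D hA cm hcm hpos))

/-- `T(hhhh)` is a rational integer. -/
theorem T_wH_im (D : Design) : (D.T wH).im = 0 := by
  rw [T_eq_Tf]; unfold Tf
  have hN := wsum_im_zero D.N (fun c => cellCoef c wH) cellCoef_wH_im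
  have hP := wsum_im_zero D.P (fun c => cellCoef c wH) cellCoef_wH_im
  simp [hN, hP]

/-! ## §4 The expansions of `Tf G4`, `Tf G3` over words, and the (A1) zeros -/

theorem Tf_G4 (D : Design) : Tf D G4 =
    D.T wH - (D.T m1000 + D.T m0100 + D.T m0010 + D.T m0001)
      + (D.T m1100 + D.T m1010 + D.T m1001 + D.T m0110 + D.T m0101 + D.T m0011)
      - (D.T m1110 + D.T m1101 + D.T m1011 + D.T m0111) + D.mu := by
  have hfun : G4 = fun c =>
      cellCoef c wH - (cellCoef c m1000 + cellCoef c m0100 + cellCoef c m0010 + cellCoef c m0001)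
        + (cellCoef c m1100 + cellCoef c m1010 + cellCoef c m1001 + cellCoef c m0110 + cellCoef c m0101 + cellCoef c m0011)
        - (cellCoef c m1110 + cellCoef c m1101 + cellCoef c m1011 + cellCoef c m0111) + cellCoef c Word.eeee :=
    funext G4_expand
  rw [hfun]
  simp only [Tf_add, Tf_sub, T_eq_Tf, Design.mu]

theorem Tf_G3 (D : Design) : Tf D G3 =
    - D.T wH + (D.T m1000 + D.T m0100 + D.T m0010) - (D.T m1100 + D.T m1010 + D.T m0110) + D.T m1110 := by
  have hfun : G3 = fun c =>
      - cellCoef c wH + (cellCoef c m1000 + cellCoef c m0100 + cellCoef c m0010)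
        - (cellCoef c m1100 + cellCoef c m1010 + cellCoef c m0110) + cellCoef c m1110 := funext G3_expand
  rw [hfun]
  simp only [Tf_add, Tf_sub, Tf_neg, T_eq_Tf]

/-- The fourteen mixed `{e,h}`-words vanish under (A1). -/
theorem mixed_zero (D : Design) (h1 : D.A1) :
    D.T m1000 = 0 ∧ D.T m0100 = 0 ∧ D.T m0010 = 0 ∧ D.T m0001 = 0 ∧
    D.T m1100 = 0 ∧ D.T m1010 = 0 ∧ D.T m1001 = 0 ∧ D.T m0110 = 0 ∧ D.T m0101 = 0 ∧ D.T m0011 = 0 ∧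
    D.T m1110 = 0 ∧ D.T m1101 = 0 ∧ D.T m1011 = 0 ∧ D.T m0111 = 0 := by
  obtain ⟨hz, _⟩ := h1
  refine ⟨hz m1000 (by unfold Word.efree m1000; decide) (by decide) (by decide),
    hz m0100 (by unfold Word.efree m0100; decide) (by decide) (by decide),
    hz m0010 (by unfold Word.efree m0010; decide) (by decide) (by decide),
    hz m0001 (by unfold Word.efree m0001; decide) (by decide) (by decide),
    hz m1100 (by unfold Word.efree m1100; decide) (by decide) (by decide),
    hz m1010 (by unfold Word.efree m1010; decide) (by decide) (by decide),
    hz m1001 (by unfold Word.efree m1001; decide) (by decide) (by decide),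
    hz m0110 (by unfold Word.efree m0110; decide) (by decide) (by decide),
    hz m0101 (by unfold Word.efree m0101; decide) (by decide) (by decide),
    hz m0011 (by unfold Word.efree m0011; decide) (by decide) (by decide),
    hz m1110 (by unfold Word.efree m1110; decide) (by decide) (by decide),
    hz m1101 (by unfold Word.efree m1101; decide) (by decide) (by decide),
    hz m1011 (by unfold Word.efree m1011; decide) (by decide) (by decide),
    hz m0111 (by unfold Word.efree m0111; decide) (by decide) (by decide)⟩

/-! ## §5 The law -/

/-- `4 ∣ T(hhhh)` for every integer (A1)-clean design on the height-14 alphabet. -/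
theorem four_dvd_T_hhhh (D : Design) (hA : D.OnAlphabet 14) (h1 : D.A1) : (4 : ℤ) ∣ (D.T wH).re := by
  obtain ⟨z1, z2, z3, _, z5, z6, _, z8, _, _, z11, _, _, _⟩ := mixed_zero D h1
  have h3 := pi3_dvd_Tf_G3 D hA
  rw [Tf_G3, z1, z2, z3, z5, z6, z8, z11] at h3
  simp only [add_zero, sub_zero] at h3
  have hneg : piG ^ 3 ∣ D.T wH := (dvd_neg).mp h3
  exact (four_dvd_of_pi_cube_dvd _ (T_wH_im D) hneg).1

/-- THE 2-ADIC μ-LAW: `4 ∣ Re μ` and `4 ∣ Im μ` for every integer (A1)-clean design on the height-14 alphabet. -/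
theorem four_dvd_mu (D : Design) (hA : D.OnAlphabet 14) (h1 : D.A1) :
    (4 : ℤ) ∣ D.mu.re ∧ (4 : ℤ) ∣ D.mu.im := by
  obtain ⟨z1, z2, z3, z4, z5, z6, z7, z8, z9, z10, z11, z12, z13, z14⟩ := mixed_zero D h1
  have h4 := pi4_dvd_Tf_G4 D hA
  rw [Tf_G4, z1, z2, z3, z4, z5, z6, z7, z8, z9, z10, z11, z12, z13, z14, piG_pow_four] at h4
  simp only [add_zero, sub_zero] at h4
  -- h4 : -4 ∣ D.T wH + D.mu
  have h4' : (4 : GaussianInt) ∣ D.T wH + D.mu := (neg_dvd).mp h4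
  have hH : (4 : GaussianInt) ∣ D.T wH := by
    have := (Zsqrtd.intCast_dvd 4 (D.T wH)).mpr ⟨four_dvd_T_hhhh D hA h1, by rw [T_wH_im D]; exact dvd_zero 4⟩
    simpa using this
  have hμ : (4 : GaussianInt) ∣ D.mu := by simpa using dvd_sub h4' hH
  exact (Zsqrtd.intCast_dvd 4 D.mu).mp (by exact_mod_cast hμ)

/-- The law in ℤ[i]: `4 ∣ μ`. -/
theorem four_dvd_mu' (D : Design) (hA : D.OnAlphabet 14) (h1 : D.A1) : (4 : GaussianInt) ∣ D.mu := by
  have := (Zsqrtd.intCast_dvd 4 D.mu).mpr (four_dvd_mu D hA h1)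
  simpa using this

/-- As an S⁺-shaped `Prop`. -/
def Law : Prop := ∀ D : Design, D.OnAlphabet 14 → D.A1 → (4 : GaussianInt) ∣ D.mu ∧ (4 : GaussianInt) ∣ D.T wH

theorem law_holds : Law := fun D hA h1 =>
  ⟨four_dvd_mu' D hA h1, by
    have := (Zsqrtd.intCast_dvd 4 (D.T wH)).mpr ⟨four_dvd_T_hhhh D hA h1, by rw [T_wH_im D]; exact dvd_zero 4⟩
    simpa using this⟩

end Summit.HodgeConjecture.HodgeConjecture.Cruxes.BlochSeedDiscOne.TwoAdicMuLaw
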